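import Summits.AtomisticToContinuum.FouriersLaw.Theorems.VanishingNoiseTransferNoiseLocalityStubResponseContinuousInNoiseAux1
import Summits.AtomisticToContinuum.FouriersLaw.Theorems.VanishingNoiseTransferNoiseLocalityStubFlipSteadyStateWellPosed
import Summits.AtomisticToContinuum.FouriersLaw.Theorems.VanishingNoiseTransferNoiseLocalityFixedNContinuity

/-!
# Stub `stub_responseContinuousInNoise` of crux `NoiseLocality` (line `fekete-transposed-uniformity`):
the fixed-`N` linear response of the flip-noisy chain is continuous in the flip rate on `[0,1]`

Crux `VanishingNoiseTransfer.NoiseLocality` (stmt-AtomisticToContinuum-11975), line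
`fekete-transposed-uniformity`, registered stub 2 (LOAD-BEARING): for the pinned anharmonic chain
`pinnedChain ω₂ lam β γ` (`ω₂, lam, β, γ > 0`), every length `N` and every `T > 0` there is `D : ℝ → ℝ`,
CONTINUOUS ON `[0,1]`, such that for every `ε ∈ [0,1]` and every per-`N` family `μ` of weak steady states of
`L + εS` that is UNIQUE at all bath temperatures `T_L, T_R > 0`, the response quotients
`totalCurrent(μ (T+δ/2) (T-δ/2))/δ` tend to `D ε` as `δ → 0`, `δ ≠ 0`. Nothing is `N`-uniform here.

Construction and proof (all inputs landed):

* `N ≤ 1`: `D ≡ 0` (a chain with at most one site has no bond, `totalCurrent ≡ 0`).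
* `N ≥ 2`. Canonical unique flip-steady families `fam ε` at every `ε ∈ [0,1]` by choice on stub 1
  (`stub_flipSteadyStateWellPosed`); their response coefficients `D ε` exist (`exists_responseCoeff_flip`:
  the response densities `stub_responseDensityNoisy` (`ε > 0`) / `stub_responseDensityDet` (`ε = 0`) give
  `HasDerivAt` of `δ ↦ totalCurrent(fam ε (T+δ/2) (T-δ/2))` at `0`, and the value at `δ = 0` is the current
  of the Gibbs measure, `0`); any unique family `μ` at rate `ε` agrees with `fam ε` at all positive
  temperatures, so it has the same response quotients near `δ = 0` (`tendsto_responseQuotient_iff_flip`).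
* Continuity on `[0,1]` (`continuousOn_Icc_of_bounds`, real analysis): at `0` the landed fixed-`N` modulus
  `|D ε − D 0| ≤ T²Kε + T√(K·D 0)√ε` (`FixedN.abs_sub_le_modulus`), which also bounds `D ≤ M` on `(0,1]`;
  on `(0,1]` the weighted Lipschitz bound `|D ε − D ε'| ≤ |ε − ε'| √(D ε/ε) √(D ε'/ε')`
  (`le_of_two_rate_bounds`) from the two-rate Duhamel bound in the flip Dirichlet form
  `|D ε − D ε'| ≤ |ε − ε'|(N−1)T²√𝓔_f(Uε)√𝓔_f(Uε')` (part 1, `helper_duhamelFlipBoundTwoRates`) and the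
  dissipation bound `ε(N−1)T²𝓔_f(Uε) ≤ D ε` (`stub_flipDissipationBound`).

No definitions.
-/

noncomputable section

open MeasureTheory Filter Topology
open scoped ContDiff

namespace Summit.AtomisticToContinuum.FouriersLaw.Theorems.NoiseLocality

open Literature.MathematicalPhysics.KineticTheory.HeatConduction
open Summit.AtomisticToContinuum.FouriersLaw.Theorems.NoiseLocality.StubResponseDensityNoisy
open Summit.AtomisticToContinuum.FouriersLaw.Theorems.NoiseLocality.StubDuhamelFlipBound
open Summit.AtomisticToContinuum.FouriersLaw.Theorems.NoiseLocality.Reduction (flipEnergy_nonneg responseCoeff_nonneg)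

namespace StubResponseContinuousInNoise

/-! ### Real analysis: continuity on `[0,1]` from a modulus at `0` and a weighted Lipschitz bound -/

/-- Algebra of the two-rate comparison: `x ≤ |ε−ε'| n T² √Eε √Eε'` together with the dissipation bounds
`ε n T² Eε ≤ Dε`, `ε' n T² Eε' ≤ Dε'` (`ε, ε' > 0`, `n ≥ 0`) give `x ≤ |ε−ε'| √(Dε/ε) √(Dε'/ε')`. [folklore] -/
theorem le_of_two_rate_bounds {x ε ε' n T Eε Eε' Dε Dε' : ℝ} (hε : 0 < ε) (hε' : 0 < ε') (hn : 0 ≤ n)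
    (h1 : x ≤ |ε - ε'| * n * T ^ 2 * Real.sqrt Eε * Real.sqrt Eε')
    (h2 : ε * n * T ^ 2 * Eε ≤ Dε) (h3 : ε' * n * T ^ 2 * Eε' ≤ Dε') :
    x ≤ |ε - ε'| * Real.sqrt (Dε / ε) * Real.sqrt (Dε' / ε') := by
  have hc : 0 ≤ n * T ^ 2 := mul_nonneg hn (sq_nonneg T)
  have e1 : n * T ^ 2 * Eε ≤ Dε / ε := by
    rw [le_div_iff₀ hε]
    calc n * T ^ 2 * Eε * ε = ε * n * T ^ 2 * Eε := by ring
      _ ≤ Dε := h2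
  have e2 : n * T ^ 2 * Eε' ≤ Dε' / ε' := by
    rw [le_div_iff₀ hε']
    calc n * T ^ 2 * Eε' * ε' = ε' * n * T ^ 2 * Eε' := by ring
      _ ≤ Dε' := h3
  have s1 : Real.sqrt (n * T ^ 2) * Real.sqrt Eε ≤ Real.sqrt (Dε / ε) := by
    rw [← Real.sqrt_mul hc]
    exact Real.sqrt_le_sqrt e1
  have s2 : Real.sqrt (n * T ^ 2) * Real.sqrt Eε' ≤ Real.sqrt (Dε' / ε') := by
    rw [← Real.sqrt_mul hc]
    exact Real.sqrt_le_sqrt e2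
  have hsq : Real.sqrt (n * T ^ 2) * Real.sqrt (n * T ^ 2) = n * T ^ 2 := Real.mul_self_sqrt hc
  calc x ≤ |ε - ε'| * n * T ^ 2 * Real.sqrt Eε * Real.sqrt Eε' := h1
    _ = |ε - ε'| * ((Real.sqrt (n * T ^ 2) * Real.sqrt Eε) * (Real.sqrt (n * T ^ 2) * Real.sqrt Eε')) := by
        calc |ε - ε'| * n * T ^ 2 * Real.sqrt Eε * Real.sqrt Eε'
            = |ε - ε'| * (Real.sqrt (n * T ^ 2) * Real.sqrt (n * T ^ 2)) * Real.sqrt Eε * Real.sqrt Eε' := by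
              rw [hsq]
              ring
          _ = _ := by ring
    _ ≤ |ε - ε'| * (Real.sqrt (Dε / ε) * Real.sqrt (Dε' / ε')) := by
        refine mul_le_mul_of_nonneg_left ?_ (abs_nonneg _)
        exact mul_le_mul s1 s2 (by positivity) (Real.sqrt_nonneg _)
    _ = |ε - ε'| * Real.sqrt (Dε / ε) * Real.sqrt (Dε' / ε') := by ring

/-- **Continuity on `[0,1]` from two bounds.** If `|D ε − D 0| ≤ m ε` on `[0,1]` with `m → 0` at `0`,
`D ≤ M` on `(0,1]` (`M ≥ 0`), and `|D ε − D ε'| ≤ |ε − ε'| √(D ε/ε) √(D ε'/ε')` on `(0,1]²`, then `D` is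
continuous on `[0,1]` (at `0` by the modulus; at `ε₀ > 0` the weight is bounded for `ε > ε₀/2`). [folklore] -/
theorem continuousOn_Icc_of_bounds {D m : ℝ → ℝ} {M : ℝ} (hM0 : 0 ≤ M)
    (hm : Tendsto m (𝓝 0) (𝓝 0))
    (h0 : ∀ ε : ℝ, 0 ≤ ε → ε ≤ 1 → |D ε - D 0| ≤ m ε)
    (hM : ∀ ε : ℝ, 0 < ε → ε ≤ 1 → D ε ≤ M)
    (h1 : ∀ ε ε' : ℝ, 0 < ε → ε ≤ 1 → 0 < ε' → ε' ≤ 1 →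
      |D ε - D ε'| ≤ |ε - ε'| * Real.sqrt (D ε / ε) * Real.sqrt (D ε' / ε')) :
    ContinuousOn D (Set.Icc 0 1) := by
  intro ε₀ hε₀
  -- a bound `|D ε - D ε₀| ≤ g ε` near `ε₀` within `[0,1]` with `g → 0` suffices
  suffices h : ∃ g : ℝ → ℝ, Tendsto g (𝓝[Set.Icc 0 1] ε₀) (𝓝 0) ∧
      ∀ᶠ ε in 𝓝[Set.Icc 0 1] ε₀, |D ε - D ε₀| ≤ g ε by
    obtain ⟨g, hg, hbound⟩ := h
    have habs : Tendsto (fun ε => |D ε - D ε₀|) (𝓝[Set.Icc 0 1] ε₀) (𝓝 0) :=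
      squeeze_zero' (Eventually.of_forall fun ε => abs_nonneg _) hbound hg
    have h2 := (tendsto_zero_iff_abs_tendsto_zero (fun ε => D ε - D ε₀)).mpr habs
    have h3 := h2.add_const (D ε₀)
    simp only [sub_add_cancel, zero_add] at h3
    exact h3
  rcases hε₀.1.eq_or_lt with h | h
  · -- `ε₀ = 0`: the modulus at `0`
    subst h
    refine ⟨m, hm.mono_left nhdsWithin_le_nhds, ?_⟩
    filter_upwards [self_mem_nhdsWithin] with ε hε using h0 ε hε.1 hε.2
  · -- `0 < ε₀ ≤ 1`: the weighted Lipschitz bound, with `D ≤ M` on `(0,1]` and `ε > ε₀/2`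
    set K : ℝ := Real.sqrt (M / (ε₀ / 2)) * Real.sqrt (M / ε₀) with hK
    refine ⟨fun ε => |ε - ε₀| * K, ?_, ?_⟩
    · have hc : Continuous fun ε : ℝ => |ε - ε₀| * K := by fun_prop
      have h2 := hc.tendsto ε₀
      simp only [sub_self, abs_zero, zero_mul] at h2
      exact h2.mono_left nhdsWithin_le_nhds
    · have hhalf : ∀ᶠ ε in 𝓝 ε₀, ε₀ / 2 < ε := eventually_gt_nhds (by linarith)
      filter_upwards [mem_nhdsWithin_of_mem_nhds hhalf, self_mem_nhdsWithin] with ε hε hmem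
      have hεpos : 0 < ε := by linarith
      have hs1 : Real.sqrt (D ε / ε) ≤ Real.sqrt (M / (ε₀ / 2)) := by
        refine Real.sqrt_le_sqrt ?_
        calc D ε / ε ≤ M / ε := div_le_div_of_nonneg_right (hM ε hεpos hmem.2) hεpos.le
          _ ≤ M / (ε₀ / 2) := div_le_div_of_nonneg_left hM0 (by linarith) hε.le
      have hs2 : Real.sqrt (D ε₀ / ε₀) ≤ Real.sqrt (M / ε₀) :=
        Real.sqrt_le_sqrt (div_le_div_of_nonneg_right (hM ε₀ h hε₀.2) h.le)
      calc |D ε - D ε₀| ≤ |ε - ε₀| * Real.sqrt (D ε / ε) * Real.sqrt (D ε₀ / ε₀) :=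
            h1 ε ε₀ hεpos hmem.2 h hε₀.2
        _ = |ε - ε₀| * (Real.sqrt (D ε / ε) * Real.sqrt (D ε₀ / ε₀)) := by ring
        _ ≤ |ε - ε₀| * K := by
            refine mul_le_mul_of_nonneg_left ?_ (abs_nonneg _)
            exact mul_le_mul hs1 hs2 (Real.sqrt_nonneg _) (Real.sqrt_nonneg _)

/-! ### Response quotients of flip-steady families -/

variable {ω₂ lam β γ : ℝ} {N : ℕ} {T : ℝ}

/-- For `T > 0` and a rate `ε`, a per-`N` family `μ0` of weak flip-steady states that is UNIQUE at all
positive temperatures and any family `μ1` of weak flip-steady states at the same rate have the same response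
quotients `totalCurrent(μ (T+δ/2) (T-δ/2))/δ` for `|δ| < T` (the two families coincide there), so `D` is a
response coefficient of the one iff of the other (flip version of
`StubUniformConductanceFloor.tendsto_responseQuotient_iff`). [folklore] -/
theorem tendsto_responseQuotient_iff_flip (P : OscillatorChain) (hT : 0 < T) (ε : ℝ)
    (μ0 μ1 : ℝ → ℝ → Measure (PhaseSpace N))
    (hμ0 : ∀ T_L T_R : ℝ, 0 < T_L → 0 < T_R → P.IsFlipSteadyState N T_L T_R ε (μ0 T_L T_R) ∧
      ∀ ν : Measure (PhaseSpace N), P.IsFlipSteadyState N T_L T_R ε ν → ν = μ0 T_L T_R)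
    (hμ1 : ∀ T_L T_R : ℝ, 0 < T_L → 0 < T_R → P.IsFlipSteadyState N T_L T_R ε (μ1 T_L T_R)) (D : ℝ) :
    Tendsto (fun δ : ℝ => P.totalCurrent (μ0 (T + δ / 2) (T - δ / 2)) / δ) (𝓝[≠] 0) (𝓝 D) ↔
      Tendsto (fun δ : ℝ => P.totalCurrent (μ1 (T + δ / 2) (T - δ / 2)) / δ) (𝓝[≠] 0) (𝓝 D) := by
  have hev : (fun δ : ℝ => P.totalCurrent (μ0 (T + δ / 2) (T - δ / 2)) / δ) =ᶠ[𝓝[≠] (0 : ℝ)]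
      fun δ : ℝ => P.totalCurrent (μ1 (T + δ / 2) (T - δ / 2)) / δ := by
    have hball : ∀ᶠ δ : ℝ in 𝓝 (0 : ℝ), |δ| < T := by
      have : Metric.ball (0 : ℝ) T ∈ 𝓝 (0 : ℝ) := Metric.ball_mem_nhds 0 hT
      filter_upwards [this] with δ hδ
      simpa [Real.dist_eq] using hδ
    filter_upwards [nhdsWithin_le_nhds hball] with δ hδ
    have h1 : 0 < T + δ / 2 := by linarith [(abs_lt.mp hδ).1]
    have h2 : 0 < T - δ / 2 := by linarith [(abs_lt.mp hδ).2]
    rw [(hμ0 _ _ h1 h2).2 _ (hμ1 _ _ h1 h2)]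
  exact ⟨fun h => h.congr' hev, fun h => h.congr' hev.symm⟩

/-- **The response coefficient from the derivative.** If `μ T T` is the Gibbs measure of the pinned chain
(no current) and `δ ↦ totalCurrent μ_{T+δ/2,T-δ/2}` has derivative `c` at `0`, then the response quotients
`totalCurrent(μ_{T+δ/2,T-δ/2})/δ` tend to `c` along `𝓝[≠] 0`. [folklore] -/
theorem tendsto_quotient_of_hasDerivAt (μ : ℝ → ℝ → Measure (PhaseSpace N))
    (hπ : μ T T = (pinnedChain ω₂ lam β γ).gibbsMeasure N T) {c : ℝ}
    (hderiv : HasDerivAt (fun δ : ℝ =>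
      (pinnedChain ω₂ lam β γ).totalCurrent (μ (T + δ / 2) (T - δ / 2))) c 0) :
    Tendsto (fun δ : ℝ => (pinnedChain ω₂ lam β γ).totalCurrent (μ (T + δ / 2) (T - δ / 2)) / δ)
      (𝓝[≠] 0) (𝓝 c) := by
  rw [hasDerivAt_iff_tendsto_slope] at hderiv
  have h0 : (pinnedChain ω₂ lam β γ).totalCurrent (μ (T + 0 / 2) (T - 0 / 2)) = 0 := by
    rw [zero_div, add_zero, sub_zero, hπ, pinnedChain_totalCurrent_gibbsMeasure]
  refine hderiv.congr' (Eventually.of_forall fun δ => ?_)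
  rw [slope_def_field, h0, sub_zero, sub_zero]

/-- A unique weak flip-steady family at rate `0` is a unique weak steady family of the deterministic chain
(`isFlipSteadyState_zero_iff`). [folklore] -/
theorem isSteadyFamily_of_flip_zero (P : OscillatorChain) (μ : ℝ → ℝ → Measure (PhaseSpace N))
    (hμ : ∀ T_L T_R : ℝ, 0 < T_L → 0 < T_R → P.IsFlipSteadyState N T_L T_R 0 (μ T_L T_R) ∧
      ∀ ν : Measure (PhaseSpace N), P.IsFlipSteadyState N T_L T_R 0 ν → ν = μ T_L T_R) :
    ∀ T_L T_R : ℝ, 0 < T_L → 0 < T_R → P.IsSteadyState N T_L T_R (μ T_L T_R) ∧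
      ∀ ν : Measure (PhaseSpace N), P.IsSteadyState N T_L T_R ν → ν = μ T_L T_R := by
  intro T_L T_R hL hR
  obtain ⟨h1, h2⟩ := hμ T_L T_R hL hR
  exact ⟨(P.isFlipSteadyState_zero_iff N T_L T_R _).1 h1, fun ν hν =>
    h2 ν ((P.isFlipSteadyState_zero_iff N T_L T_R ν).2 hν)⟩

/-- **Existence of the response coefficient of a unique flip-steady family** of the pinned chain (all
parameters `> 0`) at any rate `ε ≥ 0` and `T > 0`: the response density (`stub_responseDensityNoisy` for
`ε > 0`, `stub_responseDensityDet` for `ε = 0`) differentiates the total current at `δ = 0`, where it vanishes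
(`μ T T` is the Gibbs measure). [folklore] -/
theorem exists_responseCoeff_flip (hω : 0 < ω₂) (hl : 0 < lam) (hβ : 0 < β) (hγ : 0 < γ) (hT : 0 < T)
    {ε : ℝ} (hε : 0 ≤ ε) (μ : ℝ → ℝ → Measure (PhaseSpace N))
    (hμ : ∀ T_L T_R : ℝ, 0 < T_L → 0 < T_R →
      (pinnedChain ω₂ lam β γ).IsFlipSteadyState N T_L T_R ε (μ T_L T_R) ∧
        ∀ ν : Measure (PhaseSpace N), (pinnedChain ω₂ lam β γ).IsFlipSteadyState N T_L T_R ε ν → ν = μ T_L T_R) :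
    ∃ D : ℝ, Tendsto (fun δ : ℝ => (pinnedChain ω₂ lam β γ).totalCurrent (μ (T + δ / 2) (T - δ / 2)) / δ)
      (𝓝[≠] 0) (𝓝 D) := by
  have hπ : μ T T = (pinnedChain ω₂ lam β γ).gibbsMeasure N T :=
    flipSteadyFamily_eq_gibbsMeasure hω hl.le hβ.le γ hT ε μ hμ
  rcases hε.lt_or_eq with hε | hε
  · obtain ⟨U, -, -, hJ⟩ := stub_responseDensityNoisy ω₂ lam β γ hω hl hβ hγ T hT N ε hε μ hμ
    exact ⟨_, tendsto_quotient_of_hasDerivAt μ hπ hJ⟩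
  · subst hε
    obtain ⟨U, -, -, hJ⟩ := stub_responseDensityDet ω₂ lam β γ hω hl hβ hγ T hT N μ
      (isSteadyFamily_of_flip_zero _ μ hμ)
    exact ⟨_, tendsto_quotient_of_hasDerivAt μ hπ hJ⟩

end StubResponseContinuousInNoise

open StubResponseContinuousInNoise in
/-- **Stub 2 of line `fekete-transposed-uniformity` (fixed-`N` linear response, continuous in the noise on
`[0,1]`; LOAD-BEARING).** For `pinnedChain ω₂ lam β γ` (all parameters `> 0`), every `N` and `T > 0` there is
`D : ℝ → ℝ`, `ContinuousOn D (Set.Icc 0 1)`, such that for every `ε ∈ [0,1]` and every UNIQUE weak flip-steady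
family `μ` at rate `ε` (length `N`), `totalCurrent(μ(T+δ/2, T−δ/2))/δ → D ε` as `δ → 0`, `δ ≠ 0`.
`N ≤ 1`: `D ≡ 0`. `N ≥ 2`: `D ε` = the response coefficient of the canonical unique rate-`ε` family
(`stub_flipSteadyStateWellPosed`, `exists_responseCoeff_flip`, transported to `μ` by
`tendsto_responseQuotient_iff_flip`); continuity by `continuousOn_Icc_of_bounds` from the fixed-`N` modulus at
`0` (`FixedN.abs_sub_le_modulus`) and, on `(0,1]`, the two-rate Duhamel bound `helper_duhamelFlipBoundTwoRates`
with the dissipation bound `stub_flipDissipationBound`. [cite: BernardinOlla2011, Prop 1] -/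
theorem stub_responseContinuousInNoise :
    ∀ ω₂ lam β γ : ℝ, 0 < ω₂ → 0 < lam → 0 < β → 0 < γ →
    ∀ (N : ℕ) (T : ℝ), 0 < T →
      ∃ D : ℝ → ℝ, ContinuousOn D (Set.Icc 0 1) ∧
        ∀ ε : ℝ, 0 ≤ ε → ε ≤ 1 →
        ∀ μ : ℝ → ℝ →
            MeasureTheory.Measure (Literature.MathematicalPhysics.KineticTheory.HeatConduction.PhaseSpace N),
          (∀ T_L T_R : ℝ, 0 < T_L → 0 < T_R →
            (Literature.MathematicalPhysics.KineticTheory.HeatConduction.pinnedChain ω₂ lam β γ).IsFlipSteadyState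
                N T_L T_R ε (μ T_L T_R) ∧
              ∀ ν : MeasureTheory.Measure (Literature.MathematicalPhysics.KineticTheory.HeatConduction.PhaseSpace N),
                (Literature.MathematicalPhysics.KineticTheory.HeatConduction.pinnedChain ω₂ lam β γ).IsFlipSteadyState
                  N T_L T_R ε ν → ν = μ T_L T_R) →
          Filter.Tendsto (fun δ : ℝ =>
              (Literature.MathematicalPhysics.KineticTheory.HeatConduction.pinnedChain ω₂ lam β γ).totalCurrent
                (μ (T + δ / 2) (T - δ / 2)) / δ) (nhdsWithin 0 {(0 : ℝ)}ᶜ) (nhds (D ε)) := by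
  intro ω₂ lam β γ hω hl hβ hγ N T hT
  set P := pinnedChain ω₂ lam β γ with hP
  rcases Nat.lt_or_ge N 2 with hN | hN
  · -- `N ≤ 1`: no bond, no current, `D ≡ 0`
    have hN1 : N ≤ 1 := by omega
    refine ⟨fun _ => 0, continuousOn_const, fun ε _ _ μ _ => ?_⟩
    have h0 : (fun δ : ℝ => P.totalCurrent (μ (T + δ / 2) (T - δ / 2)) / δ) = fun _ => 0 := by
      funext δ
      rw [Summit.AtomisticToContinuum.FouriersLaw.Theorems.totalCurrent_eq_zero_of_le_one P hN1, zero_div]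
    rw [h0]
    exact tendsto_const_nhds
  -- `N ≥ 2`
  -- (1) the canonical unique flip-steady families at all rates in `[0,1]` (choice on stub 1)
  have hfamex : ∃ fam : ℝ → ℝ → ℝ → Measure (PhaseSpace N), ∀ ε : ℝ, 0 ≤ ε → ε ≤ 1 →
      ∀ T_L T_R : ℝ, 0 < T_L → 0 < T_R →
        P.IsFlipSteadyState N T_L T_R ε (fam ε T_L T_R) ∧
          ∀ ν : Measure (PhaseSpace N), P.IsFlipSteadyState N T_L T_R ε ν → ν = fam ε T_L T_R := by
    classical
    refine ⟨fun ε T_L T_R => if h : 0 ≤ ε ∧ ε ≤ 1 ∧ 0 < T_L ∧ 0 < T_R then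
        (stub_flipSteadyStateWellPosed ω₂ lam β γ hω hl hβ hγ N ε h.1 h.2.1 T_L T_R h.2.2.1 h.2.2.2).choose
      else 0, fun ε hε0 hε1 T_L T_R hL hR => ?_⟩
    have h : 0 ≤ ε ∧ ε ≤ 1 ∧ 0 < T_L ∧ 0 < T_R := ⟨hε0, hε1, hL, hR⟩
    simp only [dif_pos h]
    exact (stub_flipSteadyStateWellPosed ω₂ lam β γ hω hl hβ hγ N ε h.1 h.2.1 T_L T_R h.2.2.1 h.2.2.2).choose_spec
  obtain ⟨fam, hfam⟩ := hfamex
  -- (2) their response coefficients `D ε` (junk outside `[0,1]`)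
  have hDex : ∀ ε : ℝ, ∃ Dv : ℝ, 0 ≤ ε → ε ≤ 1 →
      Tendsto (fun δ : ℝ => P.totalCurrent (fam ε (T + δ / 2) (T - δ / 2)) / δ) (𝓝[≠] 0) (𝓝 Dv) := by
    intro ε
    by_cases h : 0 ≤ ε ∧ ε ≤ 1
    · obtain ⟨Dv, hDv⟩ := exists_responseCoeff_flip hω hl hβ hγ hT h.1 (fam ε) (hfam ε h.1 h.2)
      exact ⟨Dv, fun _ _ => hDv⟩
    · exact ⟨0, fun h0 h1 => (h ⟨h0, h1⟩).elim⟩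
  choose D hD using hDex
  refine ⟨D, ?_, fun ε hε0 hε1 μ hμ =>
    (tendsto_responseQuotient_iff_flip P hT ε (fam ε) μ (hfam ε hε0 hε1)
      (fun T_L T_R hL hR => (hμ T_L T_R hL hR).1) (D ε)).mp (hD ε hε0 hε1)⟩
  -- (3) continuity on `[0,1]`
  have hμ0 := isSteadyFamily_of_flip_zero P (fam 0) (hfam 0 le_rfl zero_le_one)
  have hD0 : Tendsto (fun δ : ℝ => P.totalCurrent (fam 0 (T + δ / 2) (T - δ / 2)) / δ) (𝓝[≠] 0) (𝓝 (D 0)) :=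
    hD 0 le_rfl zero_le_one
  have hD0nn : 0 ≤ D 0 := responseCoeff_nonneg hω hl hβ hγ hT hμ0 hD0
  obtain ⟨U0, hU0⟩ := stub_responseDensityDet ω₂ lam β γ hω hl hβ hγ T hT N (fam 0) hμ0
  set K : ℝ := max 0 (((N : ℝ) - 1) * ((1 / 2) * ∑ i : Fin N, ∫ x,
      (U0 x - U0 (momentumFlip i x)) ^ 2 ∂(P.gibbsMeasure N T))) with hKdef
  have hK0 : 0 ≤ K := le_max_left _ _
  set m : ℝ → ℝ := fun ε => T ^ 2 * K * ε + T * Real.sqrt (K * D 0) * Real.sqrt ε with hmdef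
  have hmod : ∀ ε : ℝ, 0 < ε → ε ≤ 1 → |D ε - D 0| ≤ m ε := fun ε hε hε1 =>
    FixedN.abs_sub_le_modulus hω hl hβ hγ hT N hε (fam 0) (fam ε) hμ0 (hfam ε hε.le hε1) U0 hU0 hD0
      (hD ε hε.le hε1)
  have hn : 0 ≤ (N : ℝ) - 1 := by
    have : (2 : ℝ) ≤ N := by exact_mod_cast hN
    linarith
  refine continuousOn_Icc_of_bounds (M := D 0 + (T ^ 2 * K + T * Real.sqrt (K * D 0))) (m := m)
    (by positivity) ?_ ?_ ?_ ?_
  · -- `m → 0` at `0`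
    have hcont : Continuous m := by
      simp only [hmdef]
      fun_prop
    have h := hcont.tendsto 0
    simp only [hmdef, mul_zero, Real.sqrt_zero, add_zero] at h
    exact h
  · -- the modulus at `0` on `[0,1]`
    intro ε hε0 hε1
    rcases hε0.lt_or_eq with hε | hε
    · exact hmod ε hε hε1
    · subst hε
      simp [hmdef]
  · -- the bound `D ε ≤ D 0 + m 1` on `(0,1]`
    intro ε hε hε1
    have h1 := hmod ε hε hε1
    have h2 : D ε ≤ D 0 + m ε := by
      have := le_abs_self (D ε - D 0)
      linarith
    have h3 : m ε ≤ T ^ 2 * K + T * Real.sqrt (K * D 0) := by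
      have hsq : Real.sqrt ε ≤ 1 := Real.sqrt_le_one.mpr hε1
      have ha : T ^ 2 * K * ε ≤ T ^ 2 * K := by
        calc T ^ 2 * K * ε ≤ T ^ 2 * K * 1 := mul_le_mul_of_nonneg_left hε1 (by positivity)
          _ = T ^ 2 * K := mul_one _
      have hb : T * Real.sqrt (K * D 0) * Real.sqrt ε ≤ T * Real.sqrt (K * D 0) := by
        calc T * Real.sqrt (K * D 0) * Real.sqrt ε ≤ T * Real.sqrt (K * D 0) * 1 :=
              mul_le_mul_of_nonneg_left hsq (by positivity)
          _ = T * Real.sqrt (K * D 0) := mul_one _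
      simp only [hmdef]
      linarith
    linarith
  · -- the weighted Lipschitz bound on `(0,1]`: two-rate Duhamel + dissipation
    intro ε ε' hε hε1 hε' hε'1
    have hμε := hfam ε hε.le hε1
    have hμε' := hfam ε' hε'.le hε'1
    obtain ⟨Uε, hUε⟩ := stub_responseDensityNoisy ω₂ lam β γ hω hl hβ hγ T hT N ε hε (fam ε) hμε
    obtain ⟨Uε', hUε'⟩ := stub_responseDensityNoisy ω₂ lam β γ hω hl hβ hγ T hT N ε' hε' (fam ε') hμε'
    have h1 := helper_duhamelFlipBoundTwoRates ω₂ lam β γ hω hl hβ hγ T hT N ε ε' (fam ε) (fam ε') hμε hμε'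
      Uε Uε' hUε hUε' (D ε) (D ε') (hD ε hε.le hε1) (hD ε' hε'.le hε'1)
    have h2 := stub_flipDissipationBound ω₂ lam β γ hω hl hβ hγ T hT N ε hε (fam ε) hμε Uε hUε (D ε)
      (hD ε hε.le hε1)
    have h3 := stub_flipDissipationBound ω₂ lam β γ hω hl hβ hγ T hT N ε' hε' (fam ε') hμε' Uε' hUε' (D ε')
      (hD ε' hε'.le hε'1)
    exact le_of_two_rate_bounds hε hε' hn h1 h2 h3

end Summit.AtomisticToContinuum.FouriersLaw.Theorems.NoiseLocality

end
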